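import Mathlib
import HarnessLib
import Summits.ResolutionOfSingularities.ResolutionOfSingularities.Theorems.WildQuotientsWildQuotientResolutionQuotientModelProperBirational
import Summits.ResolutionOfSingularities.ResolutionOfSingularities.Theorems.WildQuotientsWildQuotientResolutionBlowupLocalExitCharts
import Summits.ResolutionOfSingularities.ResolutionOfSingularities.Theorems.WildQuotientsWildQuotientResolutionGluedQuotientPieces
import Summits.ResolutionOfSingularities.ResolutionOfSingularities.Theorems.WildQuotientsWildQuotientResolutionCyclicTransferInvariants
import Summits.ResolutionOfSingularities.ResolutionOfSingularities.Theorems.WildQuotientsWildQuotientResolutionCyclicTransferStalkAugRestrict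
import Literature.AlgebraicGeometry.CossartPiltant200819.Prop48FundamentalLocus2008
import Literature.AlgebraicGeometry.Resolution.ProjectiveSpaceRegular
import Literature.AlgebraicGeometry.Resolution.BlowupsExistence
import Literature.AlgebraicGeometry.Resolution.ComponentGluing

/-!
# The toric exit transfer: a two-piece equivariant model, terminal on one piece, toric on the other
(crux stmt-ResolutionOfSingularities-15640 `WildQuotients.WildQuotientResolution`, line `Sketch`;
chain w45c programme V3U (`L/w45c/CHAIN.md` v5 §4 lead-1 row «V3U-F», CRUX-PLAN v5 §U (E));
[OURS · L1 W4.5c] — NOT a statement of any manuscript.)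

`ToricExit.toricExitTransfer` is the hypothesis-composed skeleton of the final assembly F1
(`jordanThree_hasResolution`, every `p ≥ 3`), in the shape of
`CyclicTransfer.cyclicDivisorialTransfer` (p459590) but WITHOUT global regularity/terminality of the
model. Data: the crux data `(X', X₁, f, q, G, ρ)` with `|G| = p`, `ρ` faithful, `X₁` AFFINE integral of
finite type and positive dimension, `q` finite surjective with orbit fibres and generically étale; an
equivariant proper birational integral model `π : V → X'` with action `ρB` over `X₁`; TWO `G`-stable
opens `Oa, Ob` of `V`, affine over `X₁`, covering `V`, with

* piece `b` Király–Lütkebohmert terminal: `Ob` regular (and non-empty) and the stalk augmentation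
  ideal principal at every fixed point of `Ob` — so `Ob/G` is regular
  (`CyclicTransfer.isRegularRing_invariantsRing_of_locallyOfFiniteType`, p459250 family, +
  `BlowupExit.exists_iso_spec_pieceQuot`, p486067);
* piece `a` carrying a closed `Ta ⊆ Oa` missing `Ob` (the locus of bad points) such that EVERY
  blow-up of the quotient piece `Oa/G` along the ideal sheaf of the (closed) image of `Ta` is regular
  (in V3U: `Oa/G ≅ (A₁-cone) × 𝔸ⁿ⁻²`, `Ta` = the vertex locus, CRUX-PLAN v5 §U (C)).

Conclusion: `X₁` has a resolution of singularities — the glued quotient `Y = V/G` (stub-3's Q1,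
p479608) is blown up along the ideal sheaf of the image of `Ta` (`BlowupExit.hasResolution_of_
isBlowup_local_of_isOpenImmersion`, p485627: an isomorphism over the regular chart `Ob/G`, a regular
blow-up over `Oa/G`), and resolutions transfer along the proper birational `Y → X₁`
(`QuotientModel.hasResolution_of_hasResolution_glued`). The J₃ instance supplies `V = Bl_{(x_a,x_b²)}𝔸ⁿ`,
`Oa = D₊(x_a t)`, `Ob = ⋂ σˡ D₊(x_b² t)` (stub-2), piece-`b` terminality
(`ToricExit.I2.isPrincipal_stalkAug_liftAction_of_mem`, p486940), and the cone description of `Oa/G`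
(stub-1 C2/C3, stub-2 D3, stub-4 C4).
-/

-- single-problem summit: the doubled namespace component `ResolutionOfSingularities` is forced
set_option linter.dupNamespace false

noncomputable section

open CategoryTheory AlgebraicGeometry TopologicalSpace
open Literature.AlgebraicGeometry.Resolution Literature.AlgebraicGeometry.RelativeSpec
open Literature.AlgebraicGeometry.CossartPiltant200819

namespace Summit.ResolutionOfSingularities.ResolutionOfSingularities.Theorems.WildQuotientResolution.ToricExit

/-- **A terminal piece has a regular quotient piece.** For an action `ρ` over an AFFINE base with
`|G| = p`, a non-empty `G`-stable open `O` (affine over the base) of the integral `X` which is regular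
and at whose fixed points the stalk augmentation ideals are principal, the quotient piece `O/G` is a
regular scheme (`O/G ≅ Spec Γ(O)^G` by `BlowupExit.exists_iso_spec_pieceQuot`, and `Γ(O)^G` is a
regular ring by the chart-level Király–Lütkebohmert transfer
`CyclicTransfer.isRegularRing_invariantsRing_of_locallyOfFiniteType`). [OURS · L1 W4.5c]
[cite: KiralyLutkebohmert2013, Thm 2] -/
theorem isRegular_pieceQuot_of_stalkAug {X Y : Scheme.{0}} {r : X ⟶ Y} {G : Type} [Group G]
    [Finite G] (ρ : ActionOver r G) [IsAffine Y] [Y.IsSeparated] [IsSeparated r]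
    [LocallyOfFiniteType r] [IsLocallyNoetherian Y] [IsIntegral X] {p : ℕ} (hp : p.Prime)
    (hcard : Nat.card G = p) (O : ρ.StableAffineOpens) (hOne : ((O.1 : X.Opens) : Set X).Nonempty)
    (hreg : Scheme.IsRegular (O.1 : Scheme.{0}))
    (hdiv : ∀ (g : G) (x : X) (hx : (ρ.aut g).hom.base x = x), x ∈ (O.1 : X.Opens) →
      (Ideal.span (Set.range fun s : X.presheaf.stalk x =>
        (X.presheaf.stalkSpecializes (specializes_of_eq hx) ≫ (ρ.aut g).hom.stalkMap x).hom s -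
          s)).IsPrincipal) :
    Scheme.IsRegular (ρ.pieceQuot O) := by
  classical
  haveI : Nonempty (O.1 : Scheme.{0}) := by
    obtain ⟨x, hx⟩ := hOne
    exact ⟨⟨x, hx⟩⟩
  haveI : IsIntegral (O.1 : Scheme.{0}) := isIntegral_of_isOpenImmersion O.1.ι
  haveI : IsAffineHom (O.1.ι ≫ r) := O.2.2
  have hinv : IsRegularRing ((ρ.restrict O.1 O.2.1).invariantsRing ⊤) := by
    refine CyclicTransfer.isRegularRing_invariantsRing_of_locallyOfFiniteType
      (ρ.restrict O.1 O.2.1) hp hcard hreg ⟨⊤, isAffineOpen_top Y⟩ fun g x hx => ?_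
    have hx' : (ρ.aut g).hom.base x.1 = x.1 := by
      have h1 := ρ.ι_restrictHom_apply O.1 O.2.1 g x
      simp only [Scheme.Opens.ι_apply] at h1
      rw [ActionOver.restrict_aut_hom] at hx
      rw [← h1, hx]
    obtain ⟨hgx', h2⟩ :=
      CyclicTransfer.stub_stalkAug_restrict ρ O.1 O.2.1 g x hx' (hdiv g x.1 hx' x.2)
    exact h2
  obtain ⟨e, -⟩ := BlowupExit.exists_iso_spec_pieceQuot ρ O
  haveI := hinv
  exact Scheme.IsRegular.of_iso e.hom (Scheme.isRegular_Spec _)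

-- the glued-quotient / blow-up bookkeeping is individually cheap but numerous
set_option maxHeartbeats 800000 in
/-- **The toric exit transfer.** Let `(X', X₁, f, q, G, ρ)` be crux data with `|G| = p`, `ρ`
faithful, `X₁` affine, integral, of finite type over `k` and of positive dimension, `q` finite
surjective with orbit fibres and étale over a dense open; `π : V → X'` an equivariant proper
birational integral model with action `ρB` over `X₁`; `Oa, Ob` two `G`-stable opens of `V`, affine
over `X₁`, with `Oa ∪ Ob = V`; `Ob` non-empty, regular, with principal stalk augmentation ideals at
its fixed points; `Ta ⊆ Oa` closed in `V` and disjoint from `Ob`, such that every blow-up of the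
quotient piece `Oa/G` along the ideal sheaf of the image of `Ta` is regular. Then `X₁` has a
resolution of singularities. [OURS · L1 W4.5c] [folklore; assembly of landed decls] -/
theorem toricExitTransfer (p : ℕ) (hp : p.Prime) (k : Type) [Field k]
    (X' X₁ : Scheme.{0}) (f : X₁ ⟶ Spec (.of k)) (q : X' ⟶ X₁) (G : Type) [Group G] [Finite G]
    (ρ : G →* Aut X') (hcard : Nat.card G = p) (hfaith : Function.Injective ρ)
    [IsAffine X₁] [LocallyOfFiniteType f] [IsIntegral X₁] [IsIntegral X']
    [IsFinite q] (hdim : ¬ topologicalKrullDim X₁ ≤ 0) (hsurj : Function.Surjective q.base)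
    (hU : ∃ U : X₁.Opens, Dense (U : Set X₁) ∧ Etale (q ∣_ U))
    (horb : ∀ x y : X', q.base x = q.base y → ∃ g : G, (ρ g).hom.base x = y)
    (V : Scheme.{0}) (π : V ⟶ X') [IsProper π] (hbir : IsBirational π) [IsIntegral V]
    (ρB : ActionOver (π ≫ q) G)
    (hequiv : ∀ g : G, (ρB.aut g).hom ≫ π = π ≫ (ρ g).hom)
    (Oa Ob : ρB.StableAffineOpens) (hcovab : Oa.1 ⊔ Ob.1 = ⊤)
    (hObne : ((Ob.1 : V.Opens) : Set V).Nonempty)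
    (hregb : Scheme.IsRegular (Ob.1 : Scheme.{0}))
    (hdivb : ∀ (g : G) (v : V) (hv : (ρB.aut g).hom.base v = v), v ∈ (Ob.1 : V.Opens) →
      (Ideal.span (Set.range fun s : V.presheaf.stalk v =>
        (V.presheaf.stalkSpecializes (specializes_of_eq hv) ≫ (ρB.aut g).hom.stalkMap v).hom s -
          s)).IsPrincipal)
    (Ta : Set V) (hTa : IsClosed Ta) (hTa1 : Ta ⊆ ((Oa.1 : V.Opens) : Set V))
    (hTa2 : Disjoint Ta ((Ob.1 : V.Opens) : Set V))
    (hPa : ∀ (Za : Closeds (ρB.pieceQuot Oa)),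
      (Za : Set (ρB.pieceQuot Oa)) = (ρB.pieceMk Oa).base '' (Oa.1.ι.base ⁻¹' Ta) →
      ∀ (B : Scheme.{0}) (pB : B ⟶ ρB.pieceQuot Oa),
        IsBlowup pB (Scheme.IdealSheafData.vanishingIdeal Za) → Scheme.IsRegular B) :
    Scheme.HasResolution X₁ := by
  classical
  -- separatedness and noetherianity
  haveI : X₁.IsSeparated := inferInstance
  haveI : X'.IsSeparated := ⟨by rw [← Limits.terminal.comp_from q]; infer_instance⟩
  haveI : IsLocallyNoetherian X₁ := LocallyOfFiniteType.isLocallyNoetherian f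
  -- the cover by `G`-stable opens affine over `X₁`
  have hcov : ∀ v : V, ∃ O : ρB.StableAffineOpens, v ∈ O.1 := by
    intro v
    have hv : v ∈ Oa.1 ⊔ Ob.1 := by rw [hcovab]; exact Opens.mem_top v
    rcases Opens.mem_sup.mp hv with h | h
    · exact ⟨Oa, h⟩
    · exact ⟨Ob, h⟩
  -- `Y = V/G`: integral, proper and birational over `X₁`
  obtain ⟨hY, hr, hrbir⟩ := QuotientModel.quotientModel_proper_birational k X' X₁ f q G ρ hfaith
    hdim hsurj hU horb V π hbir ρB hequiv hcov
  haveI := hY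
  haveI : IsLocallyNoetherian ρB.glued :=
    LocallyOfFiniteType.isLocallyNoetherian (ρB.gluedDesc (π ≫ q) ρB.aut_comp ≫ f)
  -- the two charts of `Y`
  have hcovU : (ρB.gluedι Oa).opensRange ⊔ (ρB.gluedι Ob).opensRange = ⊤ :=
    BlowupExit.opensRange_gluedι_sup_eq_top ρB hcov Oa Ob hcovab
  -- piece `b` is regular
  have hQ : Scheme.IsRegular (ρB.pieceQuot Ob) :=
    isRegular_pieceQuot_of_stalkAug ρB hp hcard Ob hObne hregb hdivb
  -- the centre: the (closed) image of `Ta` in `Y`, missing the chart `Ob/G`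
  obtain ⟨hZcl, hZdisj⟩ :=
    BlowupExit.isClosed_gluedMk_image ρB hcov Oa Ob hcovab Ta hTa hTa1 hTa2
  let Z : Closeds ρB.glued := ⟨(ρB.gluedMk hcov).base '' Ta, hZcl⟩
  have h𝓘g : (Scheme.IdealSheafData.vanishingIdeal Z).comap (ρB.gluedι Ob) = ⊤ :=
    BlowupExit.comap_vanishingIdeal_eq_top_of_disjoint Z (ρB.gluedι Ob)
      (by
        have h : Disjoint (Set.range (ρB.gluedι Ob).base) ((ρB.gluedMk hcov).base '' Ta) := by
          simpa only [Scheme.Hom.coe_opensRange] using hZdisj.symm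
        exact h)
  -- `𝓘_Z ≠ ⊥`: the non-empty chart `Ob/G` misses `Z`
  have h𝓘 : Scheme.IdealSheafData.vanishingIdeal Z ≠ ⊥ := by
    apply CP2008.vanishingIdeal_ne_bot_of_ne_univ
    obtain ⟨v, hv⟩ := hObne
    intro huniv
    have hmem : ρB.gluedMk hcov v ∈ (Z : Set ρB.glued) := by rw [huniv]; trivial
    have hrange : ρB.gluedMk hcov v ∈ ((ρB.gluedι Ob).opensRange : Set ρB.glued) := by
      change v ∈ ρB.gluedMk hcov ⁻¹ᵁ (ρB.gluedι Ob).opensRange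
      rw [ρB.preimage_opensRange_gluedι hcov Ob]
      exact hv
    exact Set.disjoint_left.mp hZdisj hmem hrange
  -- the preimage of `Z` in the chart `Oa/G` is the image of `Ta ∩ Oa`
  have hZpre : ((Z.preimage (ρB.gluedι Oa).continuous : Closeds (ρB.pieceQuot Oa)) :
      Set (ρB.pieceQuot Oa)) = (ρB.pieceMk Oa).base '' (Oa.1.ι.base ⁻¹' Ta) := by
    ext y
    simp only [Closeds.coe_preimage, Set.mem_preimage, Set.mem_image]
    constructor
    · rintro ⟨t, ht, hty⟩
      refine ⟨⟨t, hTa1 ht⟩, ht, ?_⟩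
      apply (ρB.gluedι Oa).isOpenEmbedding.injective
      rw [← hty]
      exact (ρB.gluedMk_apply hcov Oa ⟨t, hTa1 ht⟩).symm
    · rintro ⟨x, hx, rfl⟩
      exact ⟨x.1, hx, ρB.gluedMk_apply hcov Oa x⟩
  -- the blow-up of the chart `Oa/G` along the pulled-back centre is regular
  have hP : ∃ (B : Scheme.{0}) (pB : B ⟶ ρB.pieceQuot Oa),
      IsBlowup pB ((Scheme.IdealSheafData.vanishingIdeal Z).comap (ρB.gluedι Oa)) ∧
        Scheme.IsRegular B := by
    rw [comap_vanishingIdeal_of_isOpenImmersion]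
    obtain ⟨B, pB, hpB⟩ := exists_isBlowup (ρB.pieceQuot Oa)
      (Scheme.IdealSheafData.vanishingIdeal (Z.preimage (ρB.gluedι Oa).continuous))
    exact ⟨B, pB, hpB, hPa _ hZpre B pB hpB⟩
  -- the exit downstairs, transported along `Y → X₁`
  have hres : Scheme.HasResolution ρB.glued :=
    BlowupExit.hasResolution_of_isBlowup_local_of_isOpenImmersion
      (Scheme.IdealSheafData.vanishingIdeal Z) h𝓘 (ρB.gluedι Oa) (ρB.gluedι Ob) hcovU hQ h𝓘g hP
  exact QuotientModel.hasResolution_of_hasResolution_glued k X' X₁ f q G ρ hfaith hdim hsurj hU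
    horb V π hbir ρB hequiv hcov hres

end Summit.ResolutionOfSingularities.ResolutionOfSingularities.Theorems.WildQuotientResolution.ToricExit

end
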